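import Mathlib
import Summits.ValiantsHypothesis.ValiantsHypothesis.Theorems.RigidityForcesSymmetryRankRigidMinimalReprLaplaceFiveSeparatedCaptureLeadingMonomials
import Summits.ValiantsHypothesis.ValiantsHypothesis.Theorems.RigidityForcesSymmetryRankRigidMinimalReprLaplaceFiveSeparatedCaptureTwoEqualPlusLineTools

/-!
# ValiantsHypothesis / RigidityForcesSymmetry — crux `LaplaceOptimalFive` (stmt-ValiantsHypothesis-24813), symmetric capture:
# ★ **THE TWO-BINARY-SPANS LEAF** — `U₀₁, U₀₂` supported on the block `{a,b} × {a,b}`, `U₁₂` a multiple of one matrix off that block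
# ⇒ off-pair vanishing ⇒ `finrank W ≤ 3`

Brick 3 (part 6) of the `(2,2,2)♭` residue of the K1 lane (val-port-2 g6, 2026-08-29).  If every matrix of `U₀₁` and of `U₀₂` is supported
on the block `{a,b} × {a,b}` (e.g. binary pencils `⟨x_a x_b, λx_a² + μx_b²⟩`) and every matrix of `U₁₂` agrees off that block with a
multiple of one fixed matrix `A` (e.g. `U₁₂ = ⟨x_a x_b, A⟩`), then in the finite form `T_μ(p,q,r) = A_r(p,q) + B_q(p,r) + C_p(q,r)`
(✓ `L3_finite_form`) only the third family reaches the words `(p,q,r)` with `p, q ∉ {a,b}`, where it reads `c_p·A(q,r)`; square-freeness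
at `(p,p,r)` and symmetry kill it, so every obligation vanishes off the pair `{a,b}` and ✓ `finrank_le_three_of_offpair_vanishing` gives
`finrank W ≤ 3`.  Census of record (NOTE-port2g6-24813-common-line-residue.md rev 4–5): this is exactly the shape of the 18/900
configurations of the common-line census left open by ✓PG, ✓CLB, ✓CLP, LetterFlat and CommonLinePlane («two of the three planes binary»).

* ★ `finrank_le_three_of_two_block_spans` — the count.
* ★ `captureIneqSym_of_two_block_spans` — the `CaptureIneqSym` conclusion when `3 ≤ Σ finrank U_i`.

Honest framing.  A small leaf; it does not classify the common-line profile: `CaptureIneqSym` for three arbitrary planes through a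
pair-monomial line (located: `W ≤ 5 + r`, (R1) `r ≤ 1` OPEN), `CaptureIneqSym` in general, K1 on `K₃ ⊔ K₂`, `LaplaceOptimalFive`
(OPEN · CONTESTED 72/120), `RankRigidMinimalRepr` and `VP ≠ VNP` are NOT proved here.  No definitions, no `sorry`.
-/

set_option linter.dupNamespace false
set_option autoImplicit false

namespace Summit.ValiantsHypothesis.ValiantsHypothesis.Theorems.RigidityForcesSymmetryRankRigidMinimalRepr

namespace LaplaceFiveSeparatedCapture

open Finset

/-- ★ **TWO BLOCK-SUPPORTED SPANS.**  `U₀₁`, `U₀₂` supported on `{a,b} × {a,b}`; every `x ∈ U₁₂` equals `c·A` off that block (rows and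
columns outside `{a,b}`).  Then every `W` of symmetric zero-diagonal leaf matrices captured by `L3 U₀₁ U₀₂ U₁₂` has `finrank W ≤ 3`. [folklore] -/
theorem finrank_le_three_of_two_block_spans (a b : Fin 5) (hab : a ≠ b) (A : Fin 5 → Fin 5 → ℂ)
    (U01 U02 U12 W : Submodule ℂ (Fin 5 → Fin 5 → ℂ))
    (h01 : ∀ x ∈ U01, ∀ p q : Fin 5, p ≠ a → p ≠ b → x p q = 0)
    (h02 : ∀ x ∈ U02, ∀ p q : Fin 5, p ≠ a → p ≠ b → x p q = 0)
    (h12 : ∀ x ∈ U12, ∃ c : ℂ, (∀ p q : Fin 5, p ≠ a → p ≠ b → x p q = c * A p q) ∧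
      (∀ p q : Fin 5, q ≠ a → q ≠ b → x p q = c * A p q))
    (hWs : ∀ μ ∈ W, ∀ s t : Fin 5, μ s t = μ t s) (hWd : ∀ μ ∈ W, ∀ s : Fin 5, μ s s = 0)
    (hWc : ∀ μ ∈ W, contractZ μ ∈ L3 U01 U02 U12) :
    Module.finrank ℂ W ≤ 3 := by
  classical
  refine finrank_le_three_of_offpair_vanishing a b hab W hWs hWd fun μ hμ p q r hpa hpb hqa hqb => ?_
  obtain ⟨A', B', C', hA', hB', hC', hT⟩ := L3_finite_form U01 U02 U12 (hWc μ hμ)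
  choose c hc using fun p => h12 (C' p) (hC' p)
  -- on the words `(p, q, ·)` with `p, q ∉ {a,b}` only the third family survives: `T(p,q,s) = c_p A(q,s)`
  have hform : ∀ p' q' s : Fin 5, p' ≠ a → p' ≠ b → q' ≠ a → q' ≠ b → contractZ μ p' q' s = c p' * A q' s := by
    intro p' q' s hp' hp'b hq' hq'b
    rw [hT, h01 _ (hA' s) p' q' hp' hp'b, h02 _ (hB' q') p' s hp' hp'b, (hc p').1 q' s hq' hq'b, zero_add, zero_add]
  -- and, read through the middle letter, `T(p,q,s) = T(q,p,s) = c_q A(p,s)`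
  -- square-freeness at `(p,p,s)`: `c_p A(p,s) = 0`
  have hsq : ∀ p' s : Fin 5, p' ≠ a → p' ≠ b → c p' * A p' s = 0 := fun p' s hp' hp'b => by
    rw [← hform p' p' s hp' hp'b hp' hp'b]; exact contractZ_rep12 μ p' s
  -- conclusion
  rw [hform p q r hpa hpb hqa hqb]
  by_cases hcp : c p = 0
  · rw [hcp, zero_mul]
  · -- `c_p ≠ 0` gives `A(p, s) = 0` for all `s`, and `T(p,q,r) = T(q,p,r) = c_q A(p,r)`
    have hApr : A p r = 0 := by
      have := hsq p r hpa hpb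
      rcases mul_eq_zero.mp this with h | h
      · exact absurd h hcp
      · exact h
    have e : contractZ μ p q r = c q * A p r := by
      rw [← contractZ_swap12]; exact hform q p r hqa hqb hpa hpb
    rw [← hform p q r hpa hpb hqa hqb, e, hApr, mul_zero]

/-- ★ **`CaptureIneqSym` on the two-block-spans locus** (e.g. two binary pencils `⟨x_a x_b, D_i⟩`, `D_i ∈ ⟨x_a², x_b²⟩`, and a third plane
`⟨x_a x_b, A⟩`), as soon as the three finranks add up to at least 3. [folklore] -/
theorem captureIneqSym_of_two_block_spans (a b : Fin 5) (hab : a ≠ b) (A : Fin 5 → Fin 5 → ℂ)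
    (U01 U02 U12 W : Submodule ℂ (Fin 5 → Fin 5 → ℂ))
    (h01 : ∀ x ∈ U01, ∀ p q : Fin 5, p ≠ a → p ≠ b → x p q = 0)
    (h02 : ∀ x ∈ U02, ∀ p q : Fin 5, p ≠ a → p ≠ b → x p q = 0)
    (h12 : ∀ x ∈ U12, ∃ c : ℂ, (∀ p q : Fin 5, p ≠ a → p ≠ b → x p q = c * A p q) ∧
      (∀ p q : Fin 5, q ≠ a → q ≠ b → x p q = c * A p q))
    (h3 : 3 ≤ Module.finrank ℂ U01 + Module.finrank ℂ U02 + Module.finrank ℂ U12)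
    (hWs : ∀ μ ∈ W, ∀ s t : Fin 5, μ s t = μ t s) (hWd : ∀ μ ∈ W, ∀ s : Fin 5, μ s s = 0)
    (hWc : ∀ μ ∈ W, contractZ μ ∈ L3 U01 U02 U12) :
    Module.finrank ℂ W ≤ Module.finrank ℂ U01 + Module.finrank ℂ U02 + Module.finrank ℂ U12 :=
  (finrank_le_three_of_two_block_spans a b hab A U01 U02 U12 W h01 h02 h12 hWs hWd hWc).trans h3

/-- The hypothesis on `U₁₂` for a span `⟨v, A⟩` whose first generator is supported on the block `{a,b} × {a,b}`. [folklore] -/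
theorem offBlock_multiple_of_mem_span_pair (a b : Fin 5) (v A : Fin 5 → Fin 5 → ℂ)
    (hv : ∀ p q : Fin 5, p ≠ a → p ≠ b → v p q = 0) (hv' : ∀ p q : Fin 5, q ≠ a → q ≠ b → v p q = 0)
    (x : Fin 5 → Fin 5 → ℂ) (hx : x ∈ Submodule.span ℂ ({v, A} : Set (Fin 5 → Fin 5 → ℂ))) :
    ∃ c : ℂ, (∀ p q : Fin 5, p ≠ a → p ≠ b → x p q = c * A p q) ∧ (∀ p q : Fin 5, q ≠ a → q ≠ b → x p q = c * A p q) := by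
  rw [Submodule.mem_span_pair] at hx
  obtain ⟨l, c, rfl⟩ := hx
  refine ⟨c, fun p q hp hq => ?_, fun p q hp hq => ?_⟩
  · simp [hv p q hp hq]
  · simp [hv' p q hp hq]

end LaplaceFiveSeparatedCapture

end Summit.ValiantsHypothesis.ValiantsHypothesis.Theorems.RigidityForcesSymmetryRankRigidMinimalRepr
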